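import Mathlib.Algebra.Homology.ShortComplex.HomologicalComplex
import Mathlib.Algebra.Homology.ShortComplex.ModuleCat
import Mathlib.Algebra.Homology.HomologicalComplexAbelian
import Mathlib.Algebra.Category.ModuleCat.Abelian
import Literature.Algebra.Homology.OrderedCechSystemCupClasses
import HarnessLib

/-!
# A cochain map is bijective on cohomology when it is «injective and surjective up to coboundaries» on cochains

Topic `Literature/Algebra/Homology`; namespace `Literature.Algebra.Homology`.  THEOREMS ONLY (no definition, no instance,
no notation, no `sorry`).  Cell hodgecm-mathlib (D-0151), F-11 sub-line F0∕P1b (G5-c)=(T3′) «`r^*` bijective», CLASS FORM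
(B4) of B-p01 (g17)'s census `CENSUS-G5c-RefinementComparison` (second hand B-p04 (g22)): the passage from the
ELEMENTWISE statements (a cocycle whose image is a coboundary is a coboundary; every cocycle is an image up to a
coboundary) to `Function.Bijective (homologyMap F n)`, for ANY morphism `F : K ⟶ L` of `ℤ`-indexed cochain complexes of
`A`-modules — so that the Čech refinement map `refineCochain θ φ` (★ `OrderedCechSystemAlternating`), or any cochain map
CHARACTERISED degreewise, gets its class form by one `rw`.
HC_CM is proved only modulo the 7 printed citations until rung 0 closes; this file is homological algebra and asserts nothing about HC.

* `exists_cycles_of_d_eq_zero`, `homologyπ_eq_zero_iff_exists_toCycles`, `exists_homologyπ_eq` — elements of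
  `K.cycles n` ∕ `K.homology n` in `ModuleCat` (Mathlib `liftCycles`, `homologyIsCokernel`, `moduleCat_exact_iff`; ★
  `OrderedCech.cycles_ext` ∕ `homologyπ_surjective` reused);
* **`homologyMap_injective_of_cochains`**, **`homologyMap_surjective_of_cochains`**, **`homologyMap_bijective_of_cochains`**.

## References
* [Weibel1994] C. A. Weibel, *An introduction to homological algebra* (1994), §1.1 (cycles, boundaries, `H^n` of a map), Ex. 1.1.2.
* [StacksProject] The Stacks Project, Tag 0111 (homology of complexes in abelian categories; functoriality).
-/

noncomputable section

universe u

open CategoryTheory CategoryTheory.Limits HomologicalComplex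

namespace Literature.Algebra.Homology

variable {A : Type u} [CommRing A] {K L : CochainComplex (ModuleCat.{u} A) ℤ} (F : K ⟶ L)

/-! ## Elements of cycles and homology in `ModuleCat` -/

/-- A cochain with `d g = 0` is the underlying cochain of a cycle. [cite: Weibel1994, §1.1 (p. 2)] -/
theorem exists_cycles_of_d_eq_zero (K : CochainComplex (ModuleCat.{u} A) ℤ) (n : ℤ) (g : K.X n)
    (hg : (K.d n (n + 1)).hom g = 0) : ∃ z : K.cycles n, (K.iCycles n).hom z = g := by
  let k : ModuleCat.of A A ⟶ K.X n := ModuleCat.ofHom (LinearMap.toSpanSingleton A (K.X n) g)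
  have hk : k ≫ K.d n (n + 1) = 0 := by
    refine ModuleCat.hom_ext (LinearMap.ext_ring ?_)
    change (K.d n (n + 1)).hom ((1 : A) • g) = 0
    rw [one_smul, hg]
  refine ⟨(K.liftCycles k (n + 1) (by simp) hk).hom 1, ?_⟩
  change (K.liftCycles k (n + 1) (by simp) hk ≫ K.iCycles n).hom 1 = g
  rw [liftCycles_i]
  change (1 : A) • g = g
  exact one_smul A g

/-- The underlying cochain of a cycle is a cocycle. [cite: Weibel1994, §1.1 (p. 2)] -/
theorem d_iCycles_apply (K : CochainComplex (ModuleCat.{u} A) ℤ) (n : ℤ) (z : K.cycles n) :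
    (K.d n (n + 1)).hom ((K.iCycles n).hom z) = 0 := by
  have := congrArg (fun f => f.hom z) (K.iCycles_d n (n + 1))
  simp only [ModuleCat.hom_comp, LinearMap.comp_apply, ModuleCat.hom_zero, LinearMap.zero_apply] at this
  exact this

/-- The underlying cochain of `toCycles h` is `d h`. [cite: Weibel1994, §1.1 (p. 2)] -/
theorem iCycles_toCycles_apply (K : CochainComplex (ModuleCat.{u} A) ℤ) (m n : ℤ) (h : K.X m) :
    (K.iCycles n).hom ((K.toCycles m n).hom h) = (K.d m n).hom h := by
  have := congrArg (fun f => f.hom h) (K.toCycles_i m n)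
  simp only [ModuleCat.hom_comp, LinearMap.comp_apply] at this
  exact this

/-- **A class vanishes iff its cycle is a boundary**: `π z = 0 ↔ ∃ h, toCycles h = z` (`K.homology n` is the cokernel of
`toCycles : K^{n-1} → Z^n`, Mathlib `homologyIsCokernel`, read in `ModuleCat`). [cite: Weibel1994, §1.1 (p. 2)] -/
theorem homologyπ_eq_zero_iff_exists_toCycles (K : CochainComplex (ModuleCat.{u} A) ℤ) (n : ℤ) (z : K.cycles n) :
    (K.homologyπ n).hom z = 0 ↔ ∃ h : K.X (n - 1), (K.toCycles (n - 1) n).hom h = z := by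
  constructor
  · intro hz
    have hex : (ShortComplex.mk (K.toCycles (n - 1) n) (K.homologyπ n) (K.toCycles_comp_homologyπ _ _)).Exact :=
      ShortComplex.exact_of_g_is_cokernel _ (K.homologyIsCokernel (n - 1) n (by simp))
    exact (ShortComplex.moduleCat_exact_iff _).1 hex z hz
  · rintro ⟨h, rfl⟩
    have := congrArg (fun f => f.hom h) (K.toCycles_comp_homologyπ (n - 1) n)
    simp only [ModuleCat.hom_comp, LinearMap.comp_apply, ModuleCat.hom_zero, LinearMap.zero_apply] at this
    exact this

/-- Classes are represented by cycles. [cite: Weibel1994, §1.1 (p. 2)] -/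
theorem exists_homologyπ_eq (K : CochainComplex (ModuleCat.{u} A) ℤ) (n : ℤ) (x : K.homology n) :
    ∃ z : K.cycles n, (K.homologyπ n).hom z = x :=
  (ModuleCat.epi_iff_surjective _).1 inferInstance x

/-- Naturality of `π` on elements. [cite: StacksProject, Tag 0111] -/
theorem homologyMap_homologyπ_apply (n : ℤ) (z : K.cycles n) :
    (homologyMap F n).hom ((K.homologyπ n).hom z) = (L.homologyπ n).hom ((cyclesMap F n).hom z) := by
  have := congrArg (fun f => f.hom z) (homologyπ_naturality F n)
  simp only [ModuleCat.hom_comp, LinearMap.comp_apply] at this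
  exact this

/-- `cyclesMap` on underlying cochains. [cite: StacksProject, Tag 0111] -/
theorem iCycles_cyclesMap_apply (n : ℤ) (z : K.cycles n) :
    (L.iCycles n).hom ((cyclesMap F n).hom z) = (F.f n).hom ((K.iCycles n).hom z) := by
  have := congrArg (fun f => f.hom z) (cyclesMap_i F n)
  simp only [ModuleCat.hom_comp, LinearMap.comp_apply] at this
  exact this

/-! ## The criteria -/

/-- **Injectivity on cohomology from cochains**: if every `n`-cocycle `g` of `K` whose image `F g` is a coboundary
`d h` is itself a coboundary, then `H^n(F)` is injective. [cite: Weibel1994, §1.1 (p. 2) and Ex. 1.1.2] -/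
theorem homologyMap_injective_of_cochains (n : ℤ)
    (hinj : ∀ g : K.X n, (K.d n (n + 1)).hom g = 0 → ∀ h : L.X (n - 1), (F.f n).hom g = (L.d (n - 1) n).hom h →
      ∃ g₀ : K.X (n - 1), (K.d (n - 1) n).hom g₀ = g) :
    Function.Injective (homologyMap F n).hom := by
  refine (injective_iff_map_eq_zero _).2 fun x hx => ?_
  obtain ⟨z, rfl⟩ := exists_homologyπ_eq K n x
  rw [homologyMap_homologyπ_apply, homologyπ_eq_zero_iff_exists_toCycles] at hx
  obtain ⟨h, hh⟩ := hx
  have hF : (F.f n).hom ((K.iCycles n).hom z) = (L.d (n - 1) n).hom h := by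
    rw [← iCycles_cyclesMap_apply, ← hh, iCycles_toCycles_apply]
  obtain ⟨g₀, hg₀⟩ := hinj _ (d_iCycles_apply K n z) h hF
  rw [homologyπ_eq_zero_iff_exists_toCycles]
  exact ⟨g₀, OrderedCech.cycles_ext K n (by rw [iCycles_toCycles_apply, hg₀])⟩

/-- **Surjectivity on cohomology from cochains**: if every `n`-cocycle `g'` of `L` is `F g + d h` for some cocycle `g`
of `K` and cochain `h`, then `H^n(F)` is surjective. [cite: Weibel1994, §1.1 (p. 2) and Ex. 1.1.2] -/
theorem homologyMap_surjective_of_cochains (n : ℤ)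
    (hsurj : ∀ g' : L.X n, (L.d n (n + 1)).hom g' = 0 → ∃ (g : K.X n) (h : L.X (n - 1)),
      (K.d n (n + 1)).hom g = 0 ∧ (F.f n).hom g = g' + (L.d (n - 1) n).hom h) :
    Function.Surjective (homologyMap F n).hom := by
  intro y
  obtain ⟨w, rfl⟩ := exists_homologyπ_eq L n y
  obtain ⟨g, h, hg, hF⟩ := hsurj _ (d_iCycles_apply L n w)
  obtain ⟨z, hz⟩ := exists_cycles_of_d_eq_zero K n g hg
  refine ⟨(K.homologyπ n).hom z, ?_⟩
  rw [homologyMap_homologyπ_apply, ← sub_eq_zero, ← map_sub, homologyπ_eq_zero_iff_exists_toCycles]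
  exact ⟨h, OrderedCech.cycles_ext L n (by rw [iCycles_toCycles_apply, map_sub, iCycles_cyclesMap_apply, hz, hF, add_sub_cancel_left])⟩

/-- **Bijectivity on cohomology from cochains** (both criteria). For a cochain map CHARACTERISED degreewise — e.g. the
Čech refinement `(F.f n) g = refineCochain θ φ n g` of ★ `OrderedCechSystemAlternating` — rewrite `F.f n` and the
differentials (`sysComplex_d`) in the two hypotheses. [cite: Weibel1994, §1.1 (p. 2) and Ex. 1.1.2] [cite: StacksProject, Tag 0111] -/
theorem homologyMap_bijective_of_cochains (n : ℤ)
    (hinj : ∀ g : K.X n, (K.d n (n + 1)).hom g = 0 → ∀ h : L.X (n - 1), (F.f n).hom g = (L.d (n - 1) n).hom h →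
      ∃ g₀ : K.X (n - 1), (K.d (n - 1) n).hom g₀ = g)
    (hsurj : ∀ g' : L.X n, (L.d n (n + 1)).hom g' = 0 → ∃ (g : K.X n) (h : L.X (n - 1)),
      (K.d n (n + 1)).hom g = 0 ∧ (F.f n).hom g = g' + (L.d (n - 1) n).hom h) :
    Function.Bijective (homologyMap F n).hom :=
  ⟨homologyMap_injective_of_cochains F n hinj, homologyMap_surjective_of_cochains F n hsurj⟩

end Literature.Algebra.Homology

end
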